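import Summits.AtomisticToContinuum.FouriersLaw.Theorems.JunctionLocalityNonBallisticOfZeroDrudeWeight
import Summits.AtomisticToContinuum.FouriersLaw.Theorems.JunctionLocalityNonBallisticStubDrudeFromTruncationRegular

/-!
# `NonBallistic` (stmt-AtomisticToContinuum-9127) ⟸ (K) stmt-9121 ∧ `NoTruncatedDrude` stmt-11030 — line `drude-controls-conductance` COMPLETE

Lead c3, reshape R3b. After waves 1–3 EVERY stub of the line is a theorem of the tree: the lever (stubs 1–6, lead c2), the fixed-time
thermodynamic limit (DOM, WIT, F1a, F1′, F2, A1, A2 — `fixedTimeThermodynamicLimit`, `fixedTimeCurrentLocality_holds` in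
`JunctionLocalityNonBallisticOfZeroDrudeWeight.lean`) and the provable half of zero Drude weight, `stub_drudeFromTruncationRegular` (DFT′ =
route item `CurrentTiltQuench.DrudeFromTruncation`, stmt-AtomisticToContinuum-11032, restricted to REGULAR dynamics `D.carrier ⊆ 𝒳₀`: vanishing
of all truncated Drude weights ⇒ the Cesàro mean of the Green–Kubo integrand of the infinite chain vanishes; Doyon's zero-wavenumber space of the
pinned chain + von Neumann, p155805). What is left of the crux on this line is EXACTLY the conjunction of two filed items of other routes:

* (K) `BondHeatUncertainty.ExtensiveSnapshotIrreversibility` (stmt-AtomisticToContinuum-9121; NESS statics, harmonic-true), and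
* `CurrentTiltQuench.NoTruncatedDrude` (stmt-AtomisticToContinuum-11030; the anharmonic open core: no truncated Drude weight of the infinite pinned
  chain — closed there by `BridgeGlue` from `UniformQuadraticResponse` ∧ `QuenchCurrentDies` ∧ `BoundedOddRigidity`, odd macro-ergodicity).

Recorded here, sorry-free: `zeroDrudeWeightRegular_of_noTruncatedDrude` (11030 ⇒ zero Drude weight along regular witnesses, Z′ — the line's named
open core), `subballisticTransitWindow_of_zeroDrudeWeightRegular` (Z′ ⇒ R1's W), `nonBallistic_of_extensiveSnapshotIrreversibility_of_zeroDrudeWeightRegular`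
((K) ∧ Z′ ⇒ crux) and the deciding reduction **`nonBallistic_of_extensiveSnapshotIrreversibility_of_noTruncatedDrude`** ((K) ∧ 11030 ⇒ crux).
Nothing here closes the item (both hypotheses are open route items); no definitions; hypotheses spelled verbatim / by route-decl name.
-/

noncomputable section

namespace Summit.AtomisticToContinuum.FouriersLaw.Theorems.NonBallistic

open MeasureTheory ProbabilityTheory Filter Topology
open scoped NNReal ENNReal BigOperators
open Literature.MathematicalPhysics.KineticTheory
open Literature.MathematicalPhysics.KineticTheory.HeatConduction
open Summit.AtomisticToContinuum.FouriersLaw.Theorems.NonBallistic.DrudeLine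

/-- **Zero Drude weight along regular witnesses from `NoTruncatedDrude`** (Z′ ⟸ stmt-11030, through the landed DFT′ p155805): for every
shift-invariant, reversal-invariant DLR state `μ` of `pinnedChain ω₂ lam β γ` (`ω₂, lam, β > 0`) at `T > 0` and every REGULAR (`carrier ⊆ 𝒳₀`)
`μ`-preserving dynamics commuting with the shift a.e. with absolutely convergent current correlations, `τ⁻¹ ∫₀^τ D.currentCorrelation μ t dt → 0`.
[folklore] -/
theorem zeroDrudeWeightRegular_of_noTruncatedDrude :
    Summit.AtomisticToContinuum.FouriersLaw.Theses.CurrentTiltQuench.NoTruncatedDrude →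
    ∀ ω₂ lam β γ : ℝ, 0 < ω₂ → 0 < lam → 0 < β → ∀ T : ℝ, 0 < T →
      ∀ μ : Measure ChainConfig, (pinnedChain ω₂ lam β γ).IsChainGibbsMeasure T μ → IsShiftInvariant μ →
        μ.map (fun σ : ChainConfig => fun x : ℤ => ((σ x).1, -(σ x).2)) = μ →
        ∀ D : InfiniteChainDynamics (pinnedChain ω₂ lam β γ), D.carrier ⊆ (pinnedChain ω₂ lam β γ).bmGood →
          D.PreservesMeasure μ →
          (∀ t : ℝ, ∀ᵐ σ ∂μ, D.flow t (shift σ) = shift (D.flow t σ)) →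
          (∀ t : ℝ, D.HasAbsConvergentCorrelation μ t) →
          Tendsto (fun τ : ℝ => τ⁻¹ * ∫ t in (0:ℝ)..τ, D.currentCorrelation μ t) atTop (𝓝 0) := by
  intro h30 ω₂ lam β γ hω hl hβ T hT μ hG hS hR D hcar hP hcomm hAC
  exact stub_drudeFromTruncationRegular ω₂ lam β γ hω hl hβ T hT μ hG hS hR D hcar hP hcomm hAC
    (fun M hM F hF => h30 ω₂ lam β γ hω hl hβ T hT μ hG hS hR D hP hcomm M hM F hF)

/-- **`ZeroDrudeWeightLiminf` from zero Drude weight along REGULAR witnesses** (the strategist's child 2b of the crux; the witness of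
`stub_infiniteVolumeWitness` is regular, so the regular form of the open core suffices). [folklore] -/
theorem zeroDrudeWeightLiminf_of_zeroDrudeWeightRegular
    (hZ : ∀ ω₂ lam β γ : ℝ, 0 < ω₂ → 0 < lam → 0 < β → ∀ T : ℝ, 0 < T →
      ∀ μ : Measure ChainConfig, (pinnedChain ω₂ lam β γ).IsChainGibbsMeasure T μ → IsShiftInvariant μ →
        μ.map (fun σ : ChainConfig => fun x : ℤ => ((σ x).1, -(σ x).2)) = μ →
        ∀ D : InfiniteChainDynamics (pinnedChain ω₂ lam β γ), D.carrier ⊆ (pinnedChain ω₂ lam β γ).bmGood →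
          D.PreservesMeasure μ →
          (∀ t : ℝ, ∀ᵐ σ ∂μ, D.flow t (shift σ) = shift (D.flow t σ)) →
          (∀ t : ℝ, D.HasAbsConvergentCorrelation μ t) →
          Tendsto (fun τ : ℝ => τ⁻¹ * ∫ t in (0:ℝ)..τ, D.currentCorrelation μ t) atTop (𝓝 0)) :
    ∀ ω₂ lam β γ : ℝ, 0 < ω₂ → 0 < lam → 0 < β → 0 < γ → ∀ T : ℝ, 0 < T →
    ∀ C : ℕ → ℝ → ℝ,
      C = (fun (N : ℕ) (s : ℝ) => ∫ x, (∑ i : Fin N, (pinnedChain ω₂ lam β γ).bondCurrent N i x) *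
            (∫ y, (∑ i : Fin N, (pinnedChain ω₂ lam β γ).bondCurrent N i y)
              ∂((pinnedChain ω₂ lam β γ).transitionKernel N T T s.toNNReal x))
            ∂((pinnedChain ω₂ lam β γ).gibbsMeasure N T)) →
      ∀ v : ℝ → ℝ,
        (∀ t : ℝ, 0 < t →
          Tendsto (fun N : ℕ => (2 * ∫ s in (0 : ℝ)..t, (t - s) * C N s) / (N : ℝ)) atTop (𝓝 (v t))) →
        ∀ ε : ℝ, 0 < ε → ∃ t : ℝ, 0 < t ∧ v t ≤ ε * t ^ 2 := by
  intro ω₂ lam β γ hω hl hβ hγ T hT C hC v hv ε hε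
  obtain ⟨μ, D, hG, hS, hR, hcar, hP, hcomm, hAC⟩ := stub_infiniteVolumeWitness ω₂ lam β γ hω hl hβ hγ T hT
  obtain ⟨B, hB⟩ := stub_autocorrelationDomination ω₂ lam β γ hω hl hβ hγ T hT C hC
  have hlim := fixedTimeThermodynamicLimit ω₂ lam β γ hω hl hβ hγ T hT C hC μ D hG hS hcar hP hAC
  have hcont : ∀ N : ℕ, Continuous (C N) := stub_autocorrelationContinuous ω₂ lam β γ hω hl hβ hγ T hT C hC
  set g : ℝ → ℝ := Set.indicator (Set.Ici (0 : ℝ)) (D.currentCorrelation μ) with hg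
  have hgm : Measurable g := DrudeWindow.measurable_indicator_of_pointwise_limit hcont hlim
  have hg_of : ∀ s : ℝ, 0 ≤ s → g s = D.currentCorrelation μ s := fun s hs => by
    rw [hg, Set.indicator_of_mem (Set.mem_Ici.2 hs)]
  have hlim' : ∀ s : ℝ, 0 ≤ s → Tendsto (fun N : ℕ => C N s / (N : ℝ)) atTop (𝓝 (g s)) := fun s hs => by
    rw [hg_of s hs]
    exact hlim s hs
  have hgB : ∀ s : ℝ, 0 ≤ s → |g s| ≤ B := fun s hs => by
    have h1 : Tendsto (fun N : ℕ => |C N s / (N : ℝ)|) atTop (𝓝 (|g s|)) :=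
      (continuous_abs.tendsto _).comp (hlim' s hs)
    refine le_of_tendsto h1 ?_
    filter_upwards [eventually_ge_atTop 1] with N hN
    have hNpos : (0 : ℝ) < (N : ℝ) := by exact_mod_cast hN
    rw [abs_div, abs_of_pos hNpos, div_le_iff₀ hNpos]
    exact hB N s hs
  have hces0 := hZ ω₂ lam β γ hω hl hβ T hT μ hG hS hR D hcar hP hcomm hAC
  have hces : Tendsto (fun τ : ℝ => τ⁻¹ * ∫ t in (0:ℝ)..τ, g t) atTop (𝓝 0) := by
    refine hces0.congr' ?_
    filter_upwards [eventually_ge_atTop (0 : ℝ)] with τ hτ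
    congr 1
    refine intervalIntegral.integral_congr fun t ht => ?_
    rw [Set.uIcc_of_le hτ] at ht
    exact (hg_of t ht.1).symm
  obtain ⟨t, ht, hvt⟩ := stub_cesaroTwoOfCesaroOne g B hgm hgB hces ε hε
  have hmine : Tendsto (fun N : ℕ => (2 * ∫ s in (0 : ℝ)..t, (t - s) * C N s) / (N : ℝ)) atTop
      (𝓝 (2 * ∫ s in (0 : ℝ)..t, (t - s) * g s)) := stub_windowLimitOfPointwise C g B hcont hgm hB hlim' t ht
  have heq : v t = 2 * ∫ s in (0 : ℝ)..t, (t - s) * g s := tendsto_nhds_unique (hv t ht) hmine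
  exact ⟨t, ht, heq ▸ hvt⟩

/-- **W from Z′**: zero Drude weight along regular witnesses gives R1's windowed statement `DrudeLine.SubballisticTransitWindow`. [folklore] -/
theorem subballisticTransitWindow_of_zeroDrudeWeightRegular
    (hZ : ∀ ω₂ lam β γ : ℝ, 0 < ω₂ → 0 < lam → 0 < β → ∀ T : ℝ, 0 < T →
      ∀ μ : Measure ChainConfig, (pinnedChain ω₂ lam β γ).IsChainGibbsMeasure T μ → IsShiftInvariant μ →
        μ.map (fun σ : ChainConfig => fun x : ℤ => ((σ x).1, -(σ x).2)) = μ →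
        ∀ D : InfiniteChainDynamics (pinnedChain ω₂ lam β γ), D.carrier ⊆ (pinnedChain ω₂ lam β γ).bmGood →
          D.PreservesMeasure μ →
          (∀ t : ℝ, ∀ᵐ σ ∂μ, D.flow t (shift σ) = shift (D.flow t σ)) →
          (∀ t : ℝ, D.HasAbsConvergentCorrelation μ t) →
          Tendsto (fun τ : ℝ => τ⁻¹ * ∫ t in (0:ℝ)..τ, D.currentCorrelation μ t) atTop (𝓝 0)) :
    SubballisticTransitWindow :=
  subballisticTransitWindow_of_fixedTimeLocality_of_zeroDrudeWeight fixedTimeCurrentLocality_holds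
    (zeroDrudeWeightLiminf_of_zeroDrudeWeightRegular hZ)

/-- **`NonBallistic` from (K) and zero Drude weight along regular witnesses** (the open-core form of the line's composition). [folklore] -/
theorem nonBallistic_of_extensiveSnapshotIrreversibility_of_zeroDrudeWeightRegular
    (hK : Summit.AtomisticToContinuum.FouriersLaw.Theses.BondHeatUncertainty.ExtensiveSnapshotIrreversibility)
    (hZ : ∀ ω₂ lam β γ : ℝ, 0 < ω₂ → 0 < lam → 0 < β → ∀ T : ℝ, 0 < T →
      ∀ μ : Measure ChainConfig, (pinnedChain ω₂ lam β γ).IsChainGibbsMeasure T μ → IsShiftInvariant μ →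
        μ.map (fun σ : ChainConfig => fun x : ℤ => ((σ x).1, -(σ x).2)) = μ →
        ∀ D : InfiniteChainDynamics (pinnedChain ω₂ lam β γ), D.carrier ⊆ (pinnedChain ω₂ lam β γ).bmGood →
          D.PreservesMeasure μ →
          (∀ t : ℝ, ∀ᵐ σ ∂μ, D.flow t (shift σ) = shift (D.flow t σ)) →
          (∀ t : ℝ, D.HasAbsConvergentCorrelation μ t) →
          Tendsto (fun τ : ℝ => τ⁻¹ * ∫ t in (0:ℝ)..τ, D.currentCorrelation μ t) atTop (𝓝 0)) :
    Summit.AtomisticToContinuum.FouriersLaw.Theses.JunctionLocality.NonBallistic :=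
  nonBallistic_of_subballisticTransitWindow hK (subballisticTransitWindow_of_zeroDrudeWeightRegular hZ)

/-- **DECIDING REDUCTION OF THE LINE: `NonBallistic ⟸ ExtensiveSnapshotIrreversibility (stmt-9121) ∧ NoTruncatedDrude (stmt-11030)`.**
Under weak-NESS uniqueness, for every steady-state family of the pinned anharmonic chain, every `T > 0` and response coefficients `D_N`, the
conductance `D_N/(N-1)` is not bounded away from `0` — PROVIDED (K) the snapshot irreversibility of the two-temperature steady states is at most
extensive and the infinite pinned chain has no truncated Drude weight. Everything else (total-current FTUR at a fixed time, the fixed-time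
thermodynamic limit of the open chain onto the infinite chain, the removal of the truncation by the zero-wavenumber space) is proved. [folklore] -/
theorem nonBallistic_of_extensiveSnapshotIrreversibility_of_noTruncatedDrude :
    Summit.AtomisticToContinuum.FouriersLaw.Theses.BondHeatUncertainty.ExtensiveSnapshotIrreversibility →
    Summit.AtomisticToContinuum.FouriersLaw.Theses.CurrentTiltQuench.NoTruncatedDrude →
    Summit.AtomisticToContinuum.FouriersLaw.Theses.JunctionLocality.NonBallistic :=
  fun hK h30 =>
    nonBallistic_of_extensiveSnapshotIrreversibility_of_zeroDrudeWeightRegular hK (zeroDrudeWeightRegular_of_noTruncatedDrude h30)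

end Summit.AtomisticToContinuum.FouriersLaw.Theorems.NonBallistic

end
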